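import Summits.SmoothPoincare4.SmoothPoincare4.Theorems.ConvexBisectionAcyclicBisectionExistsDualHandleModelRegionDefs
import Mathlib.Analysis.Calculus.LineDeriv.Basic
import Mathlib.Analysis.Calculus.Deriv.Mul
import Mathlib.Analysis.Calculus.Deriv.Comp
import Mathlib.Analysis.Calculus.Deriv.Pow
import Mathlib.Analysis.Calculus.Deriv.Add
import HarnessLib

/-!
# Dual handles, XII: the cocore neighbourhood is `{H ≤ 0}` and the zero set of `H` is regular
(brick (H) of the sub-goal T3b "the complement of the prefix sub-handlebody is the other piece
with the DUAL suffix handles" of stub `stub_steinRealisation` (NF6), line `modp-braid-orbits`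
r11, crux `ConvexBisection.AcyclicBisectionExists`, item stmt-SmoothPoincare4-10508; wave 3,
lead c5, worker Z2)

Sequel of `…DualHandleModelRegionDefs.lean` (`N = cocoreNbhd κ δ`, `Dome = dualDome a κ δ`,
`H = modelH κ δ`, `h = modelHFun κ δ`; coordinates `P = ‖x_λ‖²`, `Q = ‖x_μ‖²`).  The model
function `H` cuts the pushed sub-handlebody `{H ≥ 0}` out of the handle `{r ≤ 1}`
(V5 report §3.2); here:

* `modelHFun_nonpos_iff` — in the quarter plane, off the corner `P > 3κ²/4`, `h ≤ 0` iff the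
  defining condition of `N` holds (zone by zone: swap slab `Q ≤ δ/4`, line zone, upper zone);
* **`cocoreNbhd_eq_setOf_modelH`: `N = {‖x‖ ≤ 1, H x ≤ 0, ‖x_λ‖² ≤ 3κ²/4}`**, and the corner
  clause is automatic off the plateau part of the seam: `{‖x‖ ≤ 1, H < 0} ⊆ N`,
  `{‖x‖ < 1, H ≤ 0} ⊆ N` (`mem_cocoreNbhd_of_modelH_neg`, `mem_cocoreNbhd_of_modelH_nonpos`);
  `N ∪ Dome ⊆ {H ≤ 0}`; the closed handle is `{H ≥ 0} ∪ N` (`modelH_nonneg_or_mem_cocoreNbhd`) and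
  `H > 0` on `{‖x‖ < 1, ‖x_λ‖² > 3κ²/4}` (`modelH_pos_of_lamSq_gt`);
* line derivatives of `H` along `x_μ` and `x_λ` (`hasDerivAt_modelHFun_mu`, flat tops of the
  cut-offs: `𝓅' = κ²` on `[1/4, ∞)`, `χ̄' = 0` on `[1/2, ∞)`);
* **`fderiv_modelH_ne_zero`: the zero set of `H` is REGULAR** on `{‖x‖ ≤ 1} ∪ {‖x_λ‖² < 1 - δ/2}`:
  `H x = 0 ⇒ fderiv ℝ H x ≠ 0` (swap slab: `∂_λ`-derivative `2P = 2𝓅 > 0`; upper zone: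
  `∂_μ`-derivative `-2Q < 0`; line zone: `H = m·(δP/κ² - Q)` with `m > 0`, `∂_μ`-derivative
  `-2Q·m < 0`), registered as `helper_modelH_regular`.

Constants: `0 < κ ≤ 1/2`, `0 < δ ≤ 1/2`.  Everything here is proved; no named facts.

## References
* J. Milnor, *Lectures on the h-cobordism theorem* (1965), §3 (dual handles). [MilnorHCobordism1965]
* J. Milnor, *Morse theory* (1963), Thm. 3.1 (regular sub/superlevel sets). [Milnor1963]
-/

noncomputable section

-- the prescribed namespace `Summit.<P>.<Sub>.…` duplicates `SmoothPoincare4` (P = Sub)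
set_option linter.dupNamespace false

open scoped Manifold ContDiff Topology

namespace Summit.SmoothPoincare4.SmoothPoincare4.Theorems.AcyclicBisectionExists.ModpBraidOrbits

open Set Function Metric
open Literature.Topology.FourManifolds Literature.Topology.FourManifolds.HandleAttachingMap

/-! ### §1 `N` is the nonpositive region of `H` in the handle -/

section Level

/-- **Off the corner `P > 3κ²/4`, `h ≤ 0` iff the defining condition of `N` holds.**
[cite: MilnorHCobordism1965, §3] -/
theorem modelHFun_nonpos_iff {κ δ P Q : ℝ} (hκ : 0 < κ) (hκ2 : κ ≤ 1 / 2) (hδ : 0 < δ)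
    (hδ2 : δ ≤ 1 / 2) (hP34 : P ≤ 3 * κ ^ 2 / 4) :
    modelHFun κ δ P Q ≤ 0 ↔
      (Q ≤ δ / 2 ∧ P ≤ pFun κ (Q / δ)) ∨ (δ / 4 ≤ Q ∧ P ≤ 3 * κ ^ 2 / 4 ∧ cocoreCurve κ δ P ≤ Q) := by
  have hκ2' : 0 < κ ^ 2 := by positivity
  have hκ4 : κ ^ 2 ≤ 1 / 4 := by nlinarith
  have hP1 : P < 1 - δ / 2 := by linarith
  rcases le_or_gt Q (δ / 4) with hQa | hQa
  · -- swap slab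
    rw [modelHFun_of_le hδ hQa, sub_nonpos]
    refine ⟨fun h => Or.inl ⟨by linarith, h⟩, ?_⟩
    rintro (⟨-, h⟩ | ⟨hQ4, -, hc⟩)
    · exact h
    · have hP2 : P ≤ κ ^ 2 / 2 := by
        by_contra hlt
        push Not at hlt
        linarith [half_lt_cocoreCurve hκ hδ hlt hP1]
      rw [cocoreCurve_of_le hκ hP2, div_le_iff₀ hκ2'] at hc
      have hs : 1 / 4 ≤ Q / δ := by rw [le_div_iff₀ hδ]; linarith
      rw [pFun_of_ge κ hs, mul_div_assoc', le_div_iff₀ hδ]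
      linarith
  rcases le_or_gt (δ / 2) Q with hQb | hQb
  · -- upper zone
    rw [modelHFun_of_ge hδ hQb, sub_nonpos]
    refine ⟨fun h => Or.inr ⟨by linarith, hP34, h⟩, ?_⟩
    rintro (⟨hQ2, h⟩ | ⟨-, -, hc⟩)
    · have hs : Q / δ = 1 / 2 := by rw [le_antisymm hQ2 hQb]; field_simp
      rw [hs, pFun_of_ge κ (by norm_num : (1 : ℝ) / 4 ≤ 1 / 2)] at h
      rw [cocoreCurve_of_le hκ (by linarith), div_le_iff₀ hκ2']
      nlinarith
    · exact hc
  · -- line zone `δ/4 < Q < δ/2`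
    have hs : 1 / 4 ≤ Q / δ := by rw [le_div_iff₀ hδ]; linarith
    rcases le_or_gt P (κ ^ 2 / 2) with hP2 | hP2
    · rw [modelHFun_line hκ hδ hQa.le hP2]
      have hm := lineMult_pos hκ hδ (Q / δ)
      have key : δ * P / κ ^ 2 - Q ≤ 0 ↔ P ≤ pFun κ (Q / δ) := by
        rw [pFun_of_ge κ hs, sub_nonpos, div_le_iff₀ hκ2', mul_div_assoc', le_div_iff₀ hδ]
        constructor <;> intro h <;> linarith
      constructor
      · intro h
        have h' : δ * P / κ ^ 2 - Q ≤ 0 := by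
          by_contra hlt
          push Not at hlt
          nlinarith [mul_pos hm hlt]
        exact Or.inl ⟨hQb.le, key.1 h'⟩
      · rintro (⟨-, h⟩ | ⟨-, -, hc⟩)
        · exact mul_nonpos_iff.2 (Or.inl ⟨hm.le, key.2 h⟩)
        · rw [cocoreCurve_of_le hκ hP2] at hc
          exact mul_nonpos_iff.2 (Or.inl ⟨hm.le, by linarith⟩)
    · -- `P > κ²/2`: `h > 0` and the condition fails
      have hc' := half_lt_cocoreCurve hκ hδ hP2 hP1
      have hpos := modelHFun_pos_of hκ hδ hQa hQb hP2 (by linarith)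
      refine ⟨fun h => absurd h (not_le.2 hpos), ?_⟩
      rintro (⟨-, h⟩ | ⟨-, -, hc⟩)
      · rw [pFun_of_ge κ hs] at h
        have : κ ^ 2 * (Q / δ) < κ ^ 2 / 2 := by
          rw [mul_div_assoc', div_lt_iff₀ hδ]; nlinarith
        linarith
      · linarith

/-- **`N = {‖x‖ ≤ 1, H ≤ 0, ‖x_λ‖² ≤ 3κ²/4}`.** [cite: MilnorHCobordism1965, §3] -/
theorem cocoreNbhd_eq_setOf_modelH {κ δ : ℝ} (hκ : 0 < κ) (hκ2 : κ ≤ 1 / 2) (hδ : 0 < δ)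
    (hδ2 : δ ≤ 1 / 2) :
    cocoreNbhd κ δ =
      {x | ‖x‖ ≤ 1 ∧ modelH κ δ x ≤ 0 ∧ ‖lamPart x‖ ^ 2 ≤ 3 * κ ^ 2 / 4} := by
  ext x
  constructor
  · intro hx
    have hP34 := lamSq_le_of_mem_cocoreNbhd hδ hx
    exact ⟨hx.1, (modelHFun_nonpos_iff hκ hκ2 hδ hδ2 hP34).2 hx.2, hP34⟩
  · rintro ⟨hx, hH, hP34⟩
    exact ⟨hx, (modelHFun_nonpos_iff hκ hκ2 hδ hδ2 hP34).1 hH⟩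

/-- In the closed handle, `H ≤ 0` forces `‖x_λ‖² ≤ 3κ²/4` unless `x` lies on the plateau part of
the seam (where `H = 1 - ‖x‖² = 0`). [folklore] -/
theorem lamSq_le_of_modelH_nonpos {κ δ : ℝ} (hκ : 0 < κ) (hκ2 : κ ≤ 1 / 2) (hδ : 0 < δ)
    {x : EuclideanSpace ℝ (Fin 4)} (hx : ‖x‖ ≤ 1) (hH : modelH κ δ x ≤ 0)
    (h' : modelH κ δ x < 0 ∨ ‖x‖ < 1) : ‖lamPart x‖ ^ 2 ≤ 3 * κ ^ 2 / 4 := by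
  by_contra hP
  push Not at hP
  have hr := (norm_le_one_iff_parts x).1 hx
  have hκ4 : κ ^ 2 ≤ 1 / 4 := by nlinarith
  rcases le_or_gt (‖muPart x‖ ^ 2) (δ / 4) with hQa | hQa
  · rw [modelH_of_le hδ hQa] at hH
    have hs : ‖muPart x‖ ^ 2 / δ ≤ 1 / 2 := by rw [div_le_iff₀ hδ]; linarith
    have := pFun_le (κ := κ) hs
    nlinarith [sq_nonneg κ]
  rcases le_or_gt (δ / 2) (‖muPart x‖ ^ 2) with hQb | hQb
  · have hHeq := modelH_eq_one_sub_norm_sq hκ hδ hP.le hQb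
    rcases h' with h' | h'
    · rw [hHeq] at h'; nlinarith [norm_nonneg x]
    · rw [hHeq] at hH; nlinarith [norm_nonneg x]
  · have hκ2' : 0 < κ ^ 2 := by positivity
    have hP2 : κ ^ 2 / 2 < ‖lamPart x‖ ^ 2 := by nlinarith [sq_nonneg κ]
    have hc : ‖muPart x‖ ^ 2 ≤ cocoreCurve κ δ (‖lamPart x‖ ^ 2) := by
      refine (le_min (by linarith) ?_).trans (min_le_cocoreCurve κ δ _)
      rw [le_div_iff₀ hκ2']; nlinarith
    have := modelHFun_pos_of hκ hδ hQa hQb hP2 hc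
    exact absurd hH (not_le.2 this)

/-- **`{‖x‖ ≤ 1, H < 0} ⊆ N`.** [folklore] -/
theorem mem_cocoreNbhd_of_modelH_neg {κ δ : ℝ} (hκ : 0 < κ) (hκ2 : κ ≤ 1 / 2) (hδ : 0 < δ) (hδ2 : δ ≤ 1 / 2)
    {x : EuclideanSpace ℝ (Fin 4)} (hx : ‖x‖ ≤ 1) (hH : modelH κ δ x < 0) : x ∈ cocoreNbhd κ δ := by
  rw [cocoreNbhd_eq_setOf_modelH hκ hκ2 hδ hδ2]
  exact ⟨hx, hH.le, lamSq_le_of_modelH_nonpos hκ hκ2 hδ hx hH.le (Or.inl hH)⟩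

/-- **`{‖x‖ < 1, H ≤ 0} ⊆ N`.** [folklore] -/
theorem mem_cocoreNbhd_of_modelH_nonpos {κ δ : ℝ} (hκ : 0 < κ) (hκ2 : κ ≤ 1 / 2) (hδ : 0 < δ)
    (hδ2 : δ ≤ 1 / 2) {x : EuclideanSpace ℝ (Fin 4)} (hx : ‖x‖ < 1) (hH : modelH κ δ x ≤ 0) :
    x ∈ cocoreNbhd κ δ := by
  rw [cocoreNbhd_eq_setOf_modelH hκ hκ2 hδ hδ2]
  exact ⟨hx.le, hH, lamSq_le_of_modelH_nonpos hκ hκ2 hδ hx.le hH (Or.inr hx)⟩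

/-- `H ≤ 0` on `N`. [folklore] -/
theorem modelH_nonpos_of_mem_cocoreNbhd {κ δ : ℝ} (hκ : 0 < κ) (hκ2 : κ ≤ 1 / 2) (hδ : 0 < δ)
    (hδ2 : δ ≤ 1 / 2) {x : EuclideanSpace ℝ (Fin 4)} (hx : x ∈ cocoreNbhd κ δ) : modelH κ δ x ≤ 0 := by
  rw [cocoreNbhd_eq_setOf_modelH hκ hκ2 hδ hδ2] at hx
  exact hx.2.1

/-- `H ≤ 0` on the dome (there `Q ≥ 1 - κ² > δ/2` and `H ≤ 1 - ‖x‖² ≤ 0`). [folklore] -/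
theorem modelH_nonpos_of_mem_dualDome {a κ δ : ℝ} (hκ : 0 < κ) (hκ2 : κ ≤ 1 / 2) (hδ : 0 < δ)
    (hδ2 : δ ≤ 1 / 2) {x : EuclideanSpace ℝ (Fin 4)} (hx : x ∈ dualDome a κ δ) : modelH κ δ x ≤ 0 := by
  obtain ⟨hP, h1, -⟩ := hx
  have hQ : δ / 2 ≤ ‖muPart x‖ ^ 2 := by
    have h := norm_sq_eq_lamPart_muPart x
    have hκ4 : κ ^ 2 ≤ 1 / 4 := by nlinarith
    linarith
  have := modelH_le_one_sub_norm_sq hκ hκ2 hδ hδ2 hQ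
  linarith

/-- **The closed handle is `{H ≥ 0} ∪ N`** (a point with `H < 0` lies in `N`). [folklore] -/
theorem modelH_nonneg_or_mem_cocoreNbhd {κ δ : ℝ} (hκ : 0 < κ) (hκ2 : κ ≤ 1 / 2) (hδ : 0 < δ)
    (hδ2 : δ ≤ 1 / 2) {x : EuclideanSpace ℝ (Fin 4)} (hx : ‖x‖ ≤ 1) :
    0 ≤ modelH κ δ x ∨ x ∈ cocoreNbhd κ δ :=
  (le_or_gt 0 (modelH κ δ x)).imp_right fun h => mem_cocoreNbhd_of_modelH_neg hκ hκ2 hδ hδ2 hx h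

/-- **`H > 0` in the open handle beyond the corner bound `‖x_λ‖² > 3κ²/4` of `N`** (so a push that
is the identity there stays in `{H > 0}`). [folklore] -/
theorem modelH_pos_of_lamSq_gt {κ δ : ℝ} (hκ : 0 < κ) (hκ2 : κ ≤ 1 / 2) (hδ : 0 < δ)
    {x : EuclideanSpace ℝ (Fin 4)} (hx : ‖x‖ < 1) (hP : 3 * κ ^ 2 / 4 < ‖lamPart x‖ ^ 2) :
    0 < modelH κ δ x := by
  by_contra h
  push Not at h
  exact absurd (lamSq_le_of_modelH_nonpos hκ hκ2 hδ hx.le h (Or.inr hx)) (not_le.2 hP)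

/-- `H ≥ 0` in the closed handle beyond the corner bound (with `H = 0` only on the seam).
[folklore] -/
theorem modelH_nonneg_of_lamSq_gt {κ δ : ℝ} (hκ : 0 < κ) (hκ2 : κ ≤ 1 / 2) (hδ : 0 < δ)
    {x : EuclideanSpace ℝ (Fin 4)} (hx : ‖x‖ ≤ 1) (hP : 3 * κ ^ 2 / 4 < ‖lamPart x‖ ^ 2) :
    0 ≤ modelH κ δ x := by
  by_contra h
  push Not at h
  exact absurd (lamSq_le_of_modelH_nonpos hκ hκ2 hδ hx h.le (Or.inl h)) (not_le.2 hP)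

end Level

/-! ### §2 Line derivatives of `H` and regularity of its zero set -/

section Regular

/-- The `λ`-part is constant along the `μ`-line through `x`. [folklore] -/
theorem lamPart_add_smul_muEmbed (x : EuclideanSpace ℝ (Fin 4)) (t : ℝ) (v : EuclideanSpace ℝ (Fin 2)) :
    lamPart (x + t • muEmbed v) = lamPart x := by
  rw [lamPart_add, lamPart_smul, lamPart_muEmbed, smul_zero, add_zero]

/-- The `μ`-part along the `μ`-line through `x` is `(1 + t) x_μ`. [folklore] -/
theorem muPart_add_smul_muEmbed (x : EuclideanSpace ℝ (Fin 4)) (t : ℝ) :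
    muPart (x + t • muEmbed (muPart x)) = (1 + t) • muPart x := by
  rw [muPart_add, muPart_smul, muPart_muEmbed, add_smul, one_smul]

/-- The `μ`-part is constant along the `λ`-line through `x`. [folklore] -/
theorem muPart_add_smul_lamEmbed (x : EuclideanSpace ℝ (Fin 4)) (t : ℝ) (v : EuclideanSpace ℝ (Fin 2)) :
    muPart (x + t • lamEmbed v) = muPart x := by
  rw [muPart_add, muPart_smul, muPart_lamEmbed, smul_zero, add_zero]

/-- The `λ`-part along the `λ`-line through `x` is `(1 + t) x_λ`. [folklore] -/
theorem lamPart_add_smul_lamEmbed (x : EuclideanSpace ℝ (Fin 4)) (t : ℝ) :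
    lamPart (x + t • lamEmbed (lamPart x)) = (1 + t) • lamPart x := by
  rw [lamPart_add, lamPart_smul, lamPart_lamEmbed, add_smul, one_smul]

/-- `H` along the `μ`-line: `h(P, (1 + t)² Q)`. [folklore] -/
theorem modelH_muLine (κ δ : ℝ) (x : EuclideanSpace ℝ (Fin 4)) (t : ℝ) :
    modelH κ δ (x + t • muEmbed (muPart x)) =
      modelHFun κ δ (‖lamPart x‖ ^ 2) ((1 + t) ^ 2 * ‖muPart x‖ ^ 2) := by
  rw [modelH, lamPart_add_smul_muEmbed, muPart_add_smul_muEmbed, norm_smul, mul_pow, Real.norm_eq_abs,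
    sq_abs]

/-- `H` along the `λ`-line: `h((1 + t)² P, Q)`. [folklore] -/
theorem modelH_lamLine (κ δ : ℝ) (x : EuclideanSpace ℝ (Fin 4)) (t : ℝ) :
    modelH κ δ (x + t • lamEmbed (lamPart x)) =
      modelHFun κ δ ((1 + t) ^ 2 * ‖lamPart x‖ ^ 2) (‖muPart x‖ ^ 2) := by
  rw [modelH, muPart_add_smul_lamEmbed, lamPart_add_smul_lamEmbed, norm_smul, mul_pow, Real.norm_eq_abs,
    sq_abs]

/-- `d/dt (1 + t)² Q = 2Q` at `t = 0`. [folklore] -/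
theorem hasDerivAt_sqLine (Q : ℝ) : HasDerivAt (fun t : ℝ => (1 + t) ^ 2 * Q) (2 * Q) 0 := by
  have h := (((hasDerivAt_id' (0 : ℝ)).const_add 1).fun_pow 2).mul_const Q
  refine h.congr_deriv ?_
  norm_num

/-- **The `μ`-line derivative of `h(P, (1+t)² Q)` at `t = 0`** for `Q/δ ≥ 1/4` (where `𝓅' = κ²`),
in terms of the derivative `dσ` of the slab cut-off at `Q/δ`. [folklore] -/
theorem hasDerivAt_modelHFun_mu {κ δ P Q dσ : ℝ} (hs : 1 / 4 ≤ Q / δ)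
    (hσ : HasDerivAt slabCut dσ (Q / δ)) :
    HasDerivAt (fun t : ℝ => modelHFun κ δ P ((1 + t) ^ 2 * Q))
      (-(dσ * (2 * Q / δ)) * (P - pFun κ (Q / δ)) - (1 - slabCut (Q / δ)) * (κ ^ 2 * (2 * Q / δ)) +
        (dσ * (2 * Q / δ) * (cocoreCurve κ δ P - Q) - slabCut (Q / δ) * (2 * Q))) 0 := by
  have hq := hasDerivAt_sqLine Q
  have hqd : HasDerivAt (fun t : ℝ => (1 + t) ^ 2 * Q / δ) (2 * Q / δ) 0 := hq.div_const δ
  have h0 : Q / δ = (fun t : ℝ => (1 + t) ^ 2 * Q / δ) 0 := by simp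
  have hσt : HasDerivAt (fun t : ℝ => slabCut ((1 + t) ^ 2 * Q / δ)) (dσ * (2 * Q / δ)) 0 :=
    hσ.comp_of_eq 0 hqd h0
  have hpt : HasDerivAt (fun t : ℝ => pFun κ ((1 + t) ^ 2 * Q / δ)) (κ ^ 2 * (2 * Q / δ)) 0 :=
    (hasDerivAt_pFun κ hs).comp_of_eq 0 hqd h0
  have h := ((hσt.const_sub 1).fun_mul (hpt.const_sub P)).fun_add
    (hσt.fun_mul (hq.const_sub (cocoreCurve κ δ P)))
  refine h.congr_deriv ?_
  simp only [add_zero, one_pow, one_mul]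
  ring

/-- **Upper zone** `Q ≥ δ/2`: the `μ`-line derivative of `H` is `-2Q`. [folklore] -/
theorem hasDerivAt_modelH_mu_of_ge {κ δ : ℝ} (hδ : 0 < δ) {x : EuclideanSpace ℝ (Fin 4)}
    (hQ : δ / 2 ≤ ‖muPart x‖ ^ 2) :
    HasDerivAt (fun t : ℝ => modelH κ δ (x + t • muEmbed (muPart x))) (-(2 * ‖muPart x‖ ^ 2)) 0 := by
  have hs : 1 / 2 ≤ ‖muPart x‖ ^ 2 / δ := by rw [le_div_iff₀ hδ]; linarith
  have h := hasDerivAt_modelHFun_mu (κ := κ) (P := ‖lamPart x‖ ^ 2) (by linarith)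
    (hasDerivAt_slabCut_of_ge hs)
  rw [slabCut_of_ge hs] at h
  rw [show (fun t : ℝ => modelH κ δ (x + t • muEmbed (muPart x))) =
      fun t => modelHFun κ δ (‖lamPart x‖ ^ 2) ((1 + t) ^ 2 * ‖muPart x‖ ^ 2) from
    funext fun t => modelH_muLine κ δ x t]
  refine h.congr_deriv ?_
  ring

/-- **Line zone** `δ/4 ≤ Q`, `P ≤ κ²/2`, at a zero of `H`: the `μ`-line derivative of `H` is
`-2Q·m`, `m = (1 - χ̄)κ²/δ + χ̄ > 0`. [folklore] -/
theorem hasDerivAt_modelH_mu_line {κ δ : ℝ} (hκ : 0 < κ) (hδ : 0 < δ) {x : EuclideanSpace ℝ (Fin 4)}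
    (hQ : δ / 4 ≤ ‖muPart x‖ ^ 2) (hP : ‖lamPart x‖ ^ 2 ≤ κ ^ 2 / 2) (h0 : modelH κ δ x = 0) :
    HasDerivAt (fun t : ℝ => modelH κ δ (x + t • muEmbed (muPart x)))
      (-(2 * ‖muPart x‖ ^ 2) *
        ((1 - slabCut (‖muPart x‖ ^ 2 / δ)) * (κ ^ 2 / δ) + slabCut (‖muPart x‖ ^ 2 / δ))) 0 := by
  set P := ‖lamPart x‖ ^ 2 with hPdef
  set Q := ‖muPart x‖ ^ 2 with hQdef
  have hκ2 : 0 < κ ^ 2 := by positivity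
  have hs : 1 / 4 ≤ Q / δ := by rw [le_div_iff₀ hδ]; linarith
  have hd : HasDerivAt slabCut (deriv slabCut (Q / δ)) (Q / δ) :=
    ((contDiff_slabCut.differentiable (by simp)) (Q / δ)).hasDerivAt
  have h := hasDerivAt_modelHFun_mu (κ := κ) (P := P) hs hd
  -- at the zero, both blended brackets vanish
  have hm := lineMult_pos hκ hδ (Q / δ)
  have hzero : δ * P / κ ^ 2 - Q = 0 := by
    have h0' : modelHFun κ δ P Q = 0 := h0
    rw [modelHFun_line hκ hδ hQ hP] at h0'
    rcases mul_eq_zero.1 h0' with h1 | h1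
    · exact absurd h1 hm.ne'
    · exact h1
  have h1 : δ * P = Q * κ ^ 2 := by rwa [sub_eq_zero, div_eq_iff hκ2.ne'] at hzero
  have hp : pFun κ (Q / δ) = P := by
    rw [pFun_of_ge κ hs]; field_simp; linarith
  have hc : cocoreCurve κ δ P = Q := by rw [cocoreCurve_of_le hκ hP]; linarith
  rw [hp, hc, sub_self, sub_self, mul_zero, mul_zero] at h
  rw [show (fun t : ℝ => modelH κ δ (x + t • muEmbed (muPart x))) =
      fun t => modelHFun κ δ P ((1 + t) ^ 2 * Q) from funext fun t => modelH_muLine κ δ x t]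
  refine h.congr_deriv ?_
  field_simp
  ring

/-- **Swap slab** `Q ≤ δ/4`: the `λ`-line derivative of `H` is `2P`. [folklore] -/
theorem hasDerivAt_modelH_lam_of_le {κ δ : ℝ} (hδ : 0 < δ) {x : EuclideanSpace ℝ (Fin 4)}
    (hQ : ‖muPart x‖ ^ 2 ≤ δ / 4) :
    HasDerivAt (fun t : ℝ => modelH κ δ (x + t • lamEmbed (lamPart x))) (2 * ‖lamPart x‖ ^ 2) 0 := by
  rw [show (fun t : ℝ => modelH κ δ (x + t • lamEmbed (lamPart x))) =
      fun t => (1 + t) ^ 2 * ‖lamPart x‖ ^ 2 - pFun κ (‖muPart x‖ ^ 2 / δ) from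
    funext fun t => by rw [modelH_lamLine, modelHFun_of_le hδ hQ]]
  exact (hasDerivAt_sqLine (‖lamPart x‖ ^ 2)).sub_const _

/-- A nonzero line derivative forces a nonzero differential. [folklore] -/
theorem fderiv_ne_zero_of_line {κ δ : ℝ} {x w : EuclideanSpace ℝ (Fin 4)} {D : ℝ}
    (hD : HasDerivAt (fun t : ℝ => modelH κ δ (x + t • w)) D 0) (hD0 : D ≠ 0) :
    fderiv ℝ (modelH κ δ) x ≠ 0 := by
  intro hf
  have hdiff : DifferentiableAt ℝ (modelH κ δ) x := (contDiff_modelH κ δ).differentiable (by simp) x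
  have h1 : HasLineDerivAt ℝ (modelH κ δ) (fderiv ℝ (modelH κ δ) x w) x w :=
    hdiff.hasFDerivAt.hasLineDerivAt w
  have h2 : fderiv ℝ (modelH κ δ) x w = D := h1.unique hD
  rw [hf] at h2
  exact hD0 (by simpa using h2.symm)

/-- **THE ZERO SET OF `H` IS REGULAR** on `{‖x‖ ≤ 1} ∪ {‖x_λ‖² < 1 - δ/2}`:
`H x = 0 ⇒ fderiv ℝ H x ≠ 0` (`0 < κ`, `0 < δ`). [cite: Milnor1963, Thm. 3.1] -/
theorem fderiv_modelH_ne_zero {κ δ : ℝ} (hκ : 0 < κ) (hδ : 0 < δ)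
    {x : EuclideanSpace ℝ (Fin 4)} (hx : ‖x‖ ≤ 1 ∨ ‖lamPart x‖ ^ 2 < 1 - δ / 2)
    (h0 : modelH κ δ x = 0) : fderiv ℝ (modelH κ δ) x ≠ 0 := by
  have hκ2' : 0 < κ ^ 2 := by positivity
  rcases le_or_gt (‖muPart x‖ ^ 2) (δ / 4) with hQa | hQa
  · -- swap slab: `P = 𝓅(Q/δ) > 0`
    have hP : ‖lamPart x‖ ^ 2 = pFun κ (‖muPart x‖ ^ 2 / δ) := by
      have h := h0; rw [modelH_of_le hδ hQa] at h; linarith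
    have hPpos : 0 < ‖lamPart x‖ ^ 2 := by
      rw [hP]; exact pFun_pos hκ (div_nonneg (sq_nonneg _) hδ.le)
    exact fderiv_ne_zero_of_line (hasDerivAt_modelH_lam_of_le hδ hQa) (by positivity)
  rcases le_or_gt (δ / 2) (‖muPart x‖ ^ 2) with hQb | hQb
  · -- upper zone: `Q > 0`
    exact fderiv_ne_zero_of_line (hasDerivAt_modelH_mu_of_ge hδ hQb) (by nlinarith)
  · -- line zone: a zero forces `P ≤ κ²/2`
    have hP2 : ‖lamPart x‖ ^ 2 ≤ κ ^ 2 / 2 := by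
      by_contra hlt
      push Not at hlt
      have hc : ‖muPart x‖ ^ 2 ≤ cocoreCurve κ δ (‖lamPart x‖ ^ 2) := by
        rcases hx with hx | hx
        · have hr := (norm_le_one_iff_parts x).1 hx
          refine (le_min (by linarith) ?_).trans (min_le_cocoreCurve κ δ _)
          rw [le_div_iff₀ hκ2']; nlinarith
        · exact (hQb.trans (half_lt_cocoreCurve hκ hδ hlt hx)).le
      have := modelHFun_pos_of hκ hδ hQa hQb hlt hc
      exact absurd h0 (ne_of_gt this)
    have hm := lineMult_pos hκ hδ (‖muPart x‖ ^ 2 / δ)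
    refine fderiv_ne_zero_of_line (hasDerivAt_modelH_mu_line hκ hδ hQa.le hP2 h0) ?_
    have hQ0 : 0 < ‖muPart x‖ ^ 2 := by linarith
    nlinarith [mul_pos hQ0 hm]

/-- **Registered helper `helper_modelH_regular` (brick (H) of T3b, sub-goal of NF6
`stub_steinRealisation`, wave 3, lead c5): the zero set of the model function `H` is regular on
`{‖x‖ ≤ 1} ∪ {‖x_λ‖² < 1 - δ/2}`.** [cite: Milnor1963, Thm. 3.1] -/
theorem helper_modelH_regular : ∀ {κ δ : ℝ}, 0 < κ → 0 < δ → ∀ (x : EuclideanSpace ℝ (Fin 4)), (‖x‖ ≤ 1 ∨ ‖Literature.Topology.FourManifolds.lamPart x‖ ^ 2 < 1 - δ / 2) → Summit.SmoothPoincare4.SmoothPoincare4.Theorems.AcyclicBisectionExists.ModpBraidOrbits.modelH κ δ x = 0 → fderiv ℝ (Summit.SmoothPoincare4.SmoothPoincare4.Theorems.AcyclicBisectionExists.ModpBraidOrbits.modelH κ δ) x ≠ 0 :=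
  fun hκ hδ _ hx h0 => fderiv_modelH_ne_zero hκ hδ hx h0

end Regular

end Summit.SmoothPoincare4.SmoothPoincare4.Theorems.AcyclicBisectionExists.ModpBraidOrbits

end
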